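import Summits.CriticalPhenomena.PercolationContinuityZ3.Theorems.PercNearOneGluingNoHeavyLowerTailTwoCopyLadderCubicGood

/-!
# Apex moves: the invariant {κ, σ, σ̃ ≥ 0} on the apex-pathwidth-2 side class (FINDING-25 §4, THEOREM K″)

Second companion to `…TwoCopyLadderCubic` (crux `stmt-CriticalPhenomena-4575`, new-inequality factory `prim-ineq-gen-1`, gen 18).
Besides the four moves of `…TwoCopyLadderCubicGood` (terminal rung, pendant at `u`, pendant at `w`, merge), a 3-terminal side
`(G; x; u, w)` may be grown by an edge between the APEX `x` and a terminal (`edgeXU`, `edgeXW`) and by a pendant edge at the apex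
(`pendX`).  The three side forms `κ` (`kappa`), `σ = p(c+p+m+d) + md − cs` (`sigma`) and its mirror `σ̃ = m(c+p+m+d) + pd − cs`
(`sigmat`) then propagate through EACH of the seven moves by exact identities with manifestly nonnegative remainders, e.g.
`(p+m)·κ(edgeXU_t L) = ((p+s)t² + (p+s)t + (p+m))·κ + (2pm + p²)t·σ̃ + m²t²(p+s)(c+p+m)`,
`σ(edgeXU_t L) = σ + (t²(p+s) + 2tp)(c+p+m+d+s)`, `σ̃(edgeXU_t L) = (1+t)σ̃`, `κ(pendX_t L) = t³κ`, `σ̃(pendU_ρ L) = ρ²σ̃ + c(2mρ + cρ + c)`.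
Hence `VGood := Good ∧ σ ≥ 0 ∧ σ̃ ≥ 0` holds on the whole class 𝒦″ generated from the one-vertex side by the seven moves
(THEOREM K″ of the memo: CONJECTURE K holds on 𝒦″ — every ladder side, every contraction-minor of one, fans at the apex,
subdivisions, multi-edges), and `Bform_nonneg_of_good` gives the q³ polarization theorem for all 2-sums of such sides.
Pure algebra (`ring` identities + sign bookkeeping); the graph-theoretic meaning of the moves is in the memo.  (This work, 2026-08-21.)
-/

namespace Summit.CriticalPhenomena.PercolationContinuityZ3.Theorems

namespace TwoCopyLadderCubic

variable {R : Type*} [CommRing R] [LinearOrder R] [IsStrictOrderedRing R]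

/-- The mirror spoke form `σ̃ = m(c+p+m+d) + pd − cs`. [this work] -/
def sigmat (L : SVec R) : R := L.m * (L.c + L.p + L.m + L.d) + L.p * L.d - L.c * L.s

/-- Edge of weight `t` between the apex `x` and the terminal `u`: `c ↦ c + t(c+m+d)`, `p ↦ p + t(p+s)`. [this work] -/
def edgeXU (t : R) (L : SVec R) : SVec R :=
  { c := L.c + t * (L.c + L.m + L.d), p := L.p + t * (L.p + L.s), m := L.m, d := L.d, s := L.s }

/-- Edge of weight `t` between the apex `x` and the terminal `w`: `c ↦ c + t(c+p+d)`, `m ↦ m + t(m+s)`. [this work] -/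
def edgeXW (t : R) (L : SVec R) : SVec R :=
  { c := L.c + t * (L.c + L.p + L.d), p := L.p, m := L.m + t * (L.m + L.s), d := L.d, s := L.s }

/-- Pendant edge of weight `t` at the apex (the new vertex becomes the apex): `c,p,m ↦ t·`, `d ↦ td + c`, `s ↦ ts + p + m`. [this work] -/
def pendX (t : R) (L : SVec R) : SVec R :=
  { c := t * L.c, p := t * L.p, m := t * L.m, d := t * L.d + L.c, s := t * L.s + L.p + L.m }

section Identities
omit [LinearOrder R] [IsStrictOrderedRing R]

/-- `κ` under an apex–`u` edge. [this work] -/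
theorem kappa_edgeXU (t : R) (L : SVec R) :
    (L.p + L.m) * kappa (edgeXU t L) = ((L.p + L.s) * t ^ 2 + (L.p + L.s) * t + (L.p + L.m)) * kappa L
      + (2 * L.p * L.m + L.p ^ 2) * t * sigmat L + L.m ^ 2 * t ^ 2 * (L.p + L.s) * (L.c + L.p + L.m) := by
  unfold kappa sigmat edgeXU; ring

/-- `κ` under an apex–`w` edge. [this work] -/
theorem kappa_edgeXW (t : R) (L : SVec R) :
    (L.p + L.m) * kappa (edgeXW t L) = ((L.m + L.s) * t ^ 2 + (L.m + L.s) * t + (L.p + L.m)) * kappa L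
      + (2 * L.p * L.m + L.m ^ 2) * t * sigma L + L.p ^ 2 * t ^ 2 * (L.m + L.s) * (L.c + L.p + L.m) := by
  unfold kappa sigma edgeXW; ring

/-- `σ` under an apex–`u` edge. [this work] -/
theorem sigma_edgeXU (t : R) (L : SVec R) :
    sigma (edgeXU t L) = sigma L + (t ^ 2 * (L.p + L.s) + 2 * t * L.p) * (L.c + L.p + L.m + L.d + L.s) := by
  unfold sigma edgeXU; ring

/-- `σ̃` under an apex–`u` edge. [this work] -/
theorem sigmat_edgeXU (t : R) (L : SVec R) : sigmat (edgeXU t L) = (1 + t) * sigmat L := by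
  unfold sigmat edgeXU; ring

/-- `σ` under an apex–`w` edge. [this work] -/
theorem sigma_edgeXW (t : R) (L : SVec R) : sigma (edgeXW t L) = (1 + t) * sigma L := by
  unfold sigma edgeXW; ring

/-- `σ̃` under an apex–`w` edge. [this work] -/
theorem sigmat_edgeXW (t : R) (L : SVec R) :
    sigmat (edgeXW t L) = sigmat L + (t ^ 2 * (L.m + L.s) + 2 * t * L.m) * (L.c + L.p + L.m + L.d + L.s) := by
  unfold sigmat edgeXW; ring

/-- The three forms under an apex pendant. [this work] -/
theorem kappa_pendX (t : R) (L : SVec R) : kappa (pendX t L) = t ^ 3 * kappa L := by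
  unfold kappa pendX; ring

/-- `σ` under an apex pendant. [this work] -/
theorem sigma_pendX (t : R) (L : SVec R) : sigma (pendX t L) = t ^ 2 * sigma L := by
  unfold sigma pendX; ring

/-- `σ̃` under an apex pendant. [this work] -/
theorem sigmat_pendX (t : R) (L : SVec R) : sigmat (pendX t L) = t ^ 2 * sigmat L := by
  unfold sigmat pendX; ring

/-- `σ̃` under the terminal moves. [this work] -/
theorem sigmat_rungStep (t : R) (L : SVec R) : sigmat (rungStep t L) = (1 + t) * sigmat L := by
  unfold sigmat rungStep; ring

/-- `σ̃` under a pendant at `u`. [this work] -/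
theorem sigmat_pendU (ρ : R) (L : SVec R) : sigmat (pendU ρ L) = ρ ^ 2 * sigmat L + L.c * (2 * L.m * ρ + L.c * ρ + L.c) := by
  unfold sigmat pendU; ring

/-- `σ̃` under a pendant at `w`. [this work] -/
theorem sigmat_pendW (ρ : R) (L : SVec R) : sigmat (pendW ρ L) = ρ ^ 2 * sigmat L := by
  unfold sigmat pendW; ring

/-- `σ̃` after a merge. [this work] -/
theorem sigmat_mergeUW (L : SVec R) : sigmat (mergeUW L) = 0 := by
  unfold sigmat mergeUW; ring

/-- `σ` under a pendant at `w` (closed form). [this work] -/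
theorem sigma_pendW' (ρ : R) (L : SVec R) : sigma (pendW ρ L) = ρ ^ 2 * sigma L + L.c * (2 * L.p * ρ + L.c * ρ + L.c) := by
  unfold sigma pendW; ring

end Identities

/-- VERY GOOD sides: good, and both spoke forms nonnegative. [this work] -/
structure VGood (L : SVec R) : Prop where
  /-- good (entries ≥ 0, κ ≥ 0, degeneracy clause) -/
  good : Good L
  /-- `σ ≥ 0` -/
  hσ : 0 ≤ sigma L
  /-- `σ̃ ≥ 0` -/
  hσt : 0 ≤ sigmat L

/-- The one-vertex side is very good. [this work] -/
theorem vgood_triv : VGood (triv : SVec R) :=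
  ⟨good_triv, by unfold sigma triv; norm_num, by unfold sigmat triv; norm_num⟩

/-- Terminal rung. [this work] -/
theorem vgood_rungStep {t : R} (ht : 0 ≤ t) {L : SVec R} (h : VGood L) : VGood (rungStep t L) :=
  ⟨good_rungStep ht h.good, by rw [sigma_rungStep]; exact mul_nonneg (by linarith) h.hσ,
    by rw [sigmat_rungStep]; exact mul_nonneg (by linarith) h.hσt⟩

/-- Merge. [this work] -/
theorem vgood_mergeUW {L : SVec R} (h : VGood L) : VGood (mergeUW L) :=
  ⟨good_mergeUW h.good, by rw [sigma_mergeUW], by rw [sigmat_mergeUW]⟩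

/-- Pendant at `u`. [this work] -/
theorem vgood_pendU {ρ : R} (hρ : 0 ≤ ρ) {L : SVec R} (h : VGood L) : VGood (pendU ρ L) := by
  obtain ⟨hg, hσ, hσt⟩ := h
  obtain ⟨hc, hp, hm, hd, hs⟩ := hg.nn
  refine ⟨good_pendU hρ hg, ?_, ?_⟩
  · rw [sigma_pendU]; exact mul_nonneg (sq_nonneg _) hσ
  · rw [sigmat_pendU]
    have : 0 ≤ L.c * (2 * L.m * ρ + L.c * ρ + L.c) := by positivity
    nlinarith [mul_nonneg (sq_nonneg ρ) hσt]

/-- Pendant at `w`. [this work] -/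
theorem vgood_pendW {ρ : R} (hρ : 0 ≤ ρ) {L : SVec R} (h : VGood L) : VGood (pendW ρ L) := by
  obtain ⟨hg, hσ, hσt⟩ := h
  obtain ⟨hc, hp, hm, hd, hs⟩ := hg.nn
  refine ⟨good_pendW hρ hg, ?_, ?_⟩
  · rw [sigma_pendW']
    have : 0 ≤ L.c * (2 * L.p * ρ + L.c * ρ + L.c) := by positivity
    nlinarith [mul_nonneg (sq_nonneg ρ) hσ]
  · rw [sigmat_pendW]; exact mul_nonneg (sq_nonneg _) hσt

/-- Pendant at the apex. [this work] -/
theorem vgood_pendX {t : R} (ht : 0 ≤ t) {L : SVec R} (h : VGood L) : VGood (pendX t L) := by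
  obtain ⟨⟨⟨hc, hp, hm, hd, hs⟩, hk, deg⟩, hσ, hσt⟩ := h
  refine ⟨⟨⟨?_, ?_, ?_, ?_, ?_⟩, ?_, ?_⟩, ?_, ?_⟩
  · show 0 ≤ t * L.c; positivity
  · show 0 ≤ t * L.p; positivity
  · show 0 ≤ t * L.m; positivity
  · show 0 ≤ t * L.d + L.c; positivity
  · show 0 ≤ t * L.s + L.p + L.m; positivity
  · rw [kappa_pendX]; exact mul_nonneg (pow_nonneg ht 3) hk
  · intro h0
    change t * L.p + t * L.m = 0 at h0
    rcases lt_or_eq_of_le ht with htp | ht0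
    · have hp0 : L.p = 0 := by nlinarith [mul_nonneg ht hp, mul_nonneg ht hm]
      have hm0 : L.m = 0 := by nlinarith [mul_nonneg ht hp, mul_nonneg ht hm]
      rcases deg (by rw [hp0, hm0]; ring) with hc0 | hs0
      · left; show t * L.c = 0; rw [hc0]; ring
      · right; show t * L.s + L.p + L.m = 0; rw [hs0, hp0, hm0]; ring
    · left; show t * L.c = 0; rw [← ht0]; ring
  · rw [sigma_pendX]; exact mul_nonneg (sq_nonneg _) hσ
  · rw [sigmat_pendX]; exact mul_nonneg (sq_nonneg _) hσt

/-- Apex–`u` edge. [this work] -/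
theorem vgood_edgeXU {t : R} (ht : 0 ≤ t) {L : SVec R} (h : VGood L) : VGood (edgeXU t L) := by
  obtain ⟨⟨⟨hc, hp, hm, hd, hs⟩, hk, deg⟩, hσ, hσt⟩ := h
  have hsum : 0 ≤ L.c + L.p + L.m + L.d + L.s := by positivity
  refine ⟨⟨⟨?_, ?_, hm, hd, hs⟩, ?_, ?_⟩, ?_, ?_⟩
  · show 0 ≤ L.c + t * (L.c + L.m + L.d); positivity
  · show 0 ≤ L.p + t * (L.p + L.s); positivity
  · -- κ
    rcases lt_or_eq_of_le (add_nonneg hp hm : 0 ≤ L.p + L.m) with hpos | h0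
    · have key := kappa_edgeXU t L
      have hrhs : 0 ≤ (L.p + L.m) * kappa (edgeXU t L) := by
        rw [key]
        have h1 : 0 ≤ ((L.p + L.s) * t ^ 2 + (L.p + L.s) * t + (L.p + L.m)) * kappa L := mul_nonneg (by positivity) hk
        have h2 : 0 ≤ (2 * L.p * L.m + L.p ^ 2) * t * sigmat L := mul_nonneg (by positivity) hσt
        have h3 : 0 ≤ L.m ^ 2 * t ^ 2 * (L.p + L.s) * (L.c + L.p + L.m) := by positivity
        linarith
      exact (mul_nonneg_iff_of_pos_left hpos).mp hrhs
    · have hp0 : L.p = 0 := by linarith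
      have hm0 : L.m = 0 := by linarith
      rcases deg h0.symm with hc0 | hs0
      · have : kappa (edgeXU t L) = 0 := by unfold kappa edgeXU; rw [hp0, hm0, hc0]; ring
        rw [this]
      · have : kappa (edgeXU t L) = 0 := by unfold kappa edgeXU; rw [hp0, hm0, hs0]; ring
        rw [this]
  · -- degeneracy clause: new p + new m = 0 forces p = m = 0 and t·s = 0
    intro h0
    change L.p + t * (L.p + L.s) + L.m = 0 at h0
    have hts : 0 ≤ t * L.s := by positivity
    have htp : 0 ≤ t * L.p := by positivity
    have hp0 : L.p = 0 := by nlinarith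
    have hm0 : L.m = 0 := by nlinarith
    have hts0 : t * L.s = 0 := by nlinarith
    rcases deg (by rw [hp0, hm0]; ring) with hc0 | hs0
    · -- c = 0: new c = t·d; if moreover t·s = 0 then either t = 0 (new c = 0) or s = 0
      rcases mul_eq_zero.mp hts0 with ht0 | hs0
      · left; show L.c + t * (L.c + L.m + L.d) = 0; rw [hc0, ht0]; ring
      · right; exact hs0
    · right; exact hs0
  · rw [sigma_edgeXU]; nlinarith [mul_nonneg (by positivity : 0 ≤ t ^ 2 * (L.p + L.s) + 2 * t * L.p) hsum]
  · rw [sigmat_edgeXU]; exact mul_nonneg (by linarith) hσt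

/-- Apex–`w` edge. [this work] -/
theorem vgood_edgeXW {t : R} (ht : 0 ≤ t) {L : SVec R} (h : VGood L) : VGood (edgeXW t L) := by
  obtain ⟨⟨⟨hc, hp, hm, hd, hs⟩, hk, deg⟩, hσ, hσt⟩ := h
  have hsum : 0 ≤ L.c + L.p + L.m + L.d + L.s := by positivity
  refine ⟨⟨⟨?_, hp, ?_, hd, hs⟩, ?_, ?_⟩, ?_, ?_⟩
  · show 0 ≤ L.c + t * (L.c + L.p + L.d); positivity
  · show 0 ≤ L.m + t * (L.m + L.s); positivity
  · rcases lt_or_eq_of_le (add_nonneg hp hm : 0 ≤ L.p + L.m) with hpos | h0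
    · have key := kappa_edgeXW t L
      have hrhs : 0 ≤ (L.p + L.m) * kappa (edgeXW t L) := by
        rw [key]
        have h1 : 0 ≤ ((L.m + L.s) * t ^ 2 + (L.m + L.s) * t + (L.p + L.m)) * kappa L := mul_nonneg (by positivity) hk
        have h2 : 0 ≤ (2 * L.p * L.m + L.m ^ 2) * t * sigma L := mul_nonneg (by positivity) hσ
        have h3 : 0 ≤ L.p ^ 2 * t ^ 2 * (L.m + L.s) * (L.c + L.p + L.m) := by positivity
        linarith
      exact (mul_nonneg_iff_of_pos_left hpos).mp hrhs
    · have hp0 : L.p = 0 := by linarith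
      have hm0 : L.m = 0 := by linarith
      rcases deg h0.symm with hc0 | hs0
      · have : kappa (edgeXW t L) = 0 := by unfold kappa edgeXW; rw [hp0, hm0, hc0]; ring
        rw [this]
      · have : kappa (edgeXW t L) = 0 := by unfold kappa edgeXW; rw [hp0, hm0, hs0]; ring
        rw [this]
  · intro h0
    change L.p + (L.m + t * (L.m + L.s)) = 0 at h0
    have hts : 0 ≤ t * L.s := by positivity
    have htm : 0 ≤ t * L.m := by positivity
    have hp0 : L.p = 0 := by nlinarith
    have hm0 : L.m = 0 := by nlinarith
    have hts0 : t * L.s = 0 := by nlinarith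
    rcases deg (by rw [hp0, hm0]; ring) with hc0 | hs0
    · rcases mul_eq_zero.mp hts0 with ht0 | hs0
      · left; show L.c + t * (L.c + L.p + L.d) = 0; rw [hc0, ht0]; ring
      · right; exact hs0
    · right; exact hs0
  · rw [sigma_edgeXW]; exact mul_nonneg (by linarith) hσ
  · rw [sigmat_edgeXW]; nlinarith [mul_nonneg (by positivity : 0 ≤ t ^ 2 * (L.m + L.s) + 2 * t * L.m) hsum]

/-- THEOREM S2 for very good sides (the 2-sum polarization theorem on the apex-pathwidth-2 class). [this work] -/
theorem Bform_nonneg_of_vgood {L K : SVec R} (hL : VGood L) (hK : VGood K) : 0 ≤ Bform L K :=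
  Bform_nonneg_of_good hL.good hK.good


/-- The spoke form is nonnegative for any very good far side (`σ ≥ 0`, entries ≥ 0) and `y ≥ 0`. [this work] -/
theorem Bspoke_nonneg_of_vgood {y : R} (hy : 0 ≤ y) {K : SVec R} (hK : VGood K) : 0 ≤ Bspoke y K := by
  obtain ⟨⟨⟨hc, hp, _, _, _⟩, _, _⟩, hσ, _⟩ := hK
  unfold Bspoke
  have h1 : 0 ≤ y ^ 2 * sigma K := mul_nonneg (sq_nonneg _) hσ
  have h2 : 0 ≤ 2 * y * K.c * K.p := by positivity
  have h3 : 0 ≤ y * K.c ^ 2 := by positivity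
  have h4 : 0 ≤ K.c ^ 2 := sq_nonneg _
  linarith

/-- The rail form is nonnegative for any two very good sides. [this work] -/
theorem Brail_nonneg_of_vgood {L K : SVec R} (hL : VGood L) (hK : VGood K) : 0 ≤ Brail L K := by
  obtain ⟨⟨⟨hc, hp, _, _, _⟩, _, _⟩, hσL, _⟩ := hL
  obtain ⟨⟨⟨hC, hP, _, _, _⟩, _, _⟩, hσK, _⟩ := hK
  unfold Brail
  have h1 : 0 ≤ K.c ^ 2 * sigma L := mul_nonneg (sq_nonneg _) hσL
  have h2 : 0 ≤ 2 * L.c * L.p * K.c * K.p := by positivity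
  have h3 : 0 ≤ L.c ^ 2 * sigma K := mul_nonneg (sq_nonneg _) hσK
  linarith

end TwoCopyLadderCubic

end Summit.CriticalPhenomena.PercolationContinuityZ3.Theorems
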